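import Summits.CriticalPhenomena.PercolationContinuityZ3.Theorems.PercNearOneGluingNoHeavyLowerTailCILPendantPeeling
import HarnessLib

/-!
# `NoHeavyLowerTail` (stmt-CriticalPhenomena-4575) — the crux reduced to the CORE STEP
# (pendant-free observer sets with at least three outside neighbours)

Prover `prim-gen-induct` (gen 6), `--supports stmt-CriticalPhenomena-4575`.  No definitions, no named facts, no sorries.

`…CILInductionStep.noHeavyLowerTail_of_step` proves the crux from the STEP hypothesis `hML`: set-champion stability
`CS_w(S, c)` for a light non-relay observer set `S` (`2 ≤ |S|`), a non-adjacent champion `c`, given `CS` for every champion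
of every weight function of smaller induction measure.  Two families of steps are now theorems:
* `PendantPeeling.step_of_pendant` (this line, gen 6): `S` has a pendant vertex (exactly one positive pair);
* `CutObserver.TwoGate.step_of_twoGate` (gen 3): all positive pairs leaving `S` end in at most two vertices.

`CoreStep.noHeavyLowerTail_of_coreStep` records the consequence: **`NoHeavyLowerTail` follows from the STEP restricted to
observer sets `S` in which every vertex with a positive pair has at least two positive pairs (no pendant) and whose
positive pairs leave `S` towards at least three distinct vertices.**  (`CoreStep.step_dispatch` is the case split used
inside the induction; the two-vertex normalisation uses the non-adjacency of `c` to supply a second outside vertex.)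
-/

noncomputable section

namespace Summit.CriticalPhenomena.PercolationContinuityZ3.Theorems

open MeasureTheory Set Literature.Probability.LatticeModels Literature.Probability.Percolation
open scoped Classical BigOperators

variable {n : ℕ}

namespace CoreStep

/-- **Dispatch of one STEP.**  In the setting of `setCS_of_step`'s hypothesis `hML` (for one `(w, S, c)` together with
the induction hypothesis `ih`): if `S` has a pendant vertex the step is `PendantPeeling.step_of_pendant`; if the positive
pairs leaving `S` end in at most two vertices it is `TwoGate.step_of_twoGate`; otherwise it is the supplied core
hypothesis `hcore`. -/
theorem step_dispatch (w : Sym2 (Fin n) → unitInterval) (A S : Finset (Fin n)) (c : Fin n) (j : ℕ)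
    (hSA : Disjoint S A) (hS2 : 2 ≤ S.card) (hcA : c ∈ A)
    (hchamp : ∀ a ∈ A,
      (prodBernoulli w).real {ω : BondConfig (Fin n) | (A.filter fun z => ω ∈ openConn a z).card ≤ j} ≤
        (prodBernoulli w).real {ω : BondConfig (Fin n) | (A.filter fun z => ω ∈ openConn c z).card ≤ j})
    (hout : ∃ v ∈ S, ∃ y, y ∉ S ∧ w s(v, y) ≠ 0)
    (hna : ∀ v ∈ S, w s(c, v) = 0)
    (ih : ∀ w' : Sym2 (Fin n) → unitInterval,
      (Fintype.card (Sym2 (Fin n)) + 1) * (Finset.univ.filter fun e => w' e ≠ 0).card +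
          (Finset.univ.filter fun e => w' e ≠ 0 ∧ w' e ≠ 1).card <
        (Fintype.card (Sym2 (Fin n)) + 1) * (Finset.univ.filter fun e => w e ≠ 0).card +
          (Finset.univ.filter fun e => w e ≠ 0 ∧ w e ≠ 1).card →
      ∀ (T : Finset (Fin n)) (x : Fin n), Disjoint T A → T.Nonempty → x ∈ A →
      (∀ a ∈ A, (prodBernoulli w').real {ω : BondConfig (Fin n) | (A.filter fun z => ω ∈ openConn a z).card ≤ j} ≤
        (prodBernoulli w').real {ω : BondConfig (Fin n) | (A.filter fun z => ω ∈ openConn x z).card ≤ j}) →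
      (prodBernoulli w').real {ω : BondConfig (Fin n) | (∀ y ∈ T, ω ∉ openConn x y) ∧
          1 ≤ (A.filter fun z => ∃ y ∈ T, ω ∈ openConn y z).card ∧
          (A.filter fun z => ∃ y ∈ T, ω ∈ openConn y z).card ≤ j} ≤
        (prodBernoulli w').real {ω : BondConfig (Fin n) | (∀ y ∈ T, ω ∉ openConn x y) ∧
          (A.filter fun z => ω ∈ openConn x z).card ≤ j})
    (hcore : (∀ v ∈ S, ∀ g : Fin n, g ≠ v → w s(v, g) ≠ 0 → ∃ u : Fin n, u ≠ v ∧ u ≠ g ∧ w s(v, u) ≠ 0) →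
      (∀ y z : Fin n, ∃ v ∈ S, ∃ u : Fin n, u ∉ S ∧ u ≠ y ∧ u ≠ z ∧ w s(v, u) ≠ 0) →
      (prodBernoulli w).real {ω : BondConfig (Fin n) | (∀ y ∈ S, ω ∉ openConn c y) ∧
          1 ≤ (A.filter fun z => ∃ y ∈ S, ω ∈ openConn y z).card ∧
          (A.filter fun z => ∃ y ∈ S, ω ∈ openConn y z).card ≤ j} ≤
        (prodBernoulli w).real {ω : BondConfig (Fin n) | (∀ y ∈ S, ω ∉ openConn c y) ∧
          (A.filter fun z => ω ∈ openConn c z).card ≤ j}) :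
    (prodBernoulli w).real {ω : BondConfig (Fin n) | (∀ y ∈ S, ω ∉ openConn c y) ∧
        1 ≤ (A.filter fun z => ∃ y ∈ S, ω ∈ openConn y z).card ∧
        (A.filter fun z => ∃ y ∈ S, ω ∈ openConn y z).card ≤ j} ≤
      (prodBernoulli w).real {ω : BondConfig (Fin n) | (∀ y ∈ S, ω ∉ openConn c y) ∧
        (A.filter fun z => ω ∈ openConn c z).card ≤ j} := by
  -- (a) a pendant vertex
  by_cases hp : ∃ v ∈ S, ∃ g : Fin n, g ≠ v ∧ w s(v, g) ≠ 0 ∧ ∀ u : Fin n, u ≠ v → u ≠ g → w s(v, u) = 0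
  · obtain ⟨v, hvS, g, hgv, hwg, hpend⟩ := hp
    exact PendantPeeling.step_of_pendant w A S c v g j hSA hcA hvS hgv hS2 hwg hpend hchamp ih
  -- (b) at most two outside neighbours
  by_cases h2 : ∃ y z : Fin n, ∀ v ∈ S, ∀ u : Fin n, u ∉ S → u ≠ y → u ≠ z → w s(v, u) = 0
  · obtain ⟨y, z, hyz⟩ := h2
    obtain ⟨v₀, hv₀S, u₀, hu₀S, hwu₀⟩ := hout
    have hcS : c ∉ S := fun h => Finset.disjoint_left.1 hSA h hcA
    have hu₀c : u₀ ≠ c := by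
      intro h; subst h
      have := hna v₀ hv₀S
      rw [Sym2.eq_swap] at this
      exact hwu₀ this
    have hu₀yz : u₀ = y ∨ u₀ = z := by
      by_contra hcon
      push Not at hcon
      exact hwu₀ (hyz v₀ hv₀S u₀ hu₀S hcon.1 hcon.2)
    -- second outside neighbour, if any; otherwise use `c`
    by_cases hsec : ∃ v₁ ∈ S, ∃ u₁ : Fin n, u₁ ∉ S ∧ u₁ ≠ u₀ ∧ w s(v₁, u₁) ≠ 0
    · obtain ⟨v₁, hv₁S, u₁, hu₁S, hu₁u₀, hwu₁⟩ := hsec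
      have hu₁yz : u₁ = y ∨ u₁ = z := by
        by_contra hcon
        push Not at hcon
        exact hwu₁ (hyz v₁ hv₁S u₁ hu₁S hcon.1 hcon.2)
      have hsupp : ∀ v ∈ S, ∀ u, u ∉ S → w s(v, u) ≠ 0 → u = u₀ ∨ u = u₁ := by
        intro v hv u huS hwu
        have huyz : u = y ∨ u = z := by
          by_contra hcon
          push Not at hcon
          exact hwu (hyz v hv u huS hcon.1 hcon.2)
        rcases huyz with rfl | rfl <;> rcases hu₀yz with h0 | h0 <;> rcases hu₁yz with h1 | h1
        all_goals first | exact Or.inl h0.symm | exact Or.inr h1.symm | exact absurd (h0.trans h1.symm) hu₁u₀.symm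
      exact CutObserver.TwoGate.step_of_twoGate w A S c u₀ u₁ j hSA hcA hu₁u₀.symm hu₀S hu₁S hsupp hchamp
        ⟨v₀, hv₀S, u₀, hu₀S, hwu₀⟩ ih
    · push Not at hsec
      have hsupp : ∀ v ∈ S, ∀ u, u ∉ S → w s(v, u) ≠ 0 → u = u₀ ∨ u = c := by
        intro v hv u huS hwu
        by_cases huu₀ : u = u₀
        · exact Or.inl huu₀
        · exact absurd (hsec v hv u huS huu₀) hwu
      exact CutObserver.TwoGate.step_of_twoGate w A S c u₀ c j hSA hcA hu₀c hu₀S hcS hsupp hchamp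
        ⟨v₀, hv₀S, u₀, hu₀S, hwu₀⟩ ih
  -- (c) the core step
  · push Not at hp h2
    refine hcore ?_ h2
    intro v hv g hgv hwg
    obtain ⟨u, huv, hug, hwu⟩ := hp v hv g hgv hwg
    exact ⟨u, huv, hug, hwu⟩

/-- **The crux from the CORE STEP.**  `NoHeavyLowerTail` follows from set-champion stability at pendant-free observer
sets with at least three outside neighbours (all other steps of the induction of `setCS_of_step` being theorems:
isolated sets, heavy members, adjacent champions, pendants, at most two outside neighbours). -/
theorem noHeavyLowerTail_of_coreStep
    (hcore : ∀ (n : ℕ) (w : Sym2 (Fin n) → unitInterval) (A S : Finset (Fin n)) (c : Fin n) (j : ℕ),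
      Disjoint S A → 2 ≤ S.card → c ∈ A →
      (∀ a ∈ A, (prodBernoulli w).real {ω : BondConfig (Fin n) | (A.filter fun z => ω ∈ openConn a z).card ≤ j} ≤
        (prodBernoulli w).real {ω : BondConfig (Fin n) | (A.filter fun z => ω ∈ openConn c z).card ≤ j}) →
      (∀ v ∈ S, (prodBernoulli w).real {ω : BondConfig (Fin n) | (A.filter fun z => ω ∈ openConn c z).card ≤ j} <
        (prodBernoulli w).real {ω : BondConfig (Fin n) | (A.filter fun z => ω ∈ openConn v z).card ≤ j}) →
      (∃ v ∈ S, ∃ y, y ∉ S ∧ w s(v, y) ≠ 0) →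
      (∀ v ∈ S, w s(c, v) = 0) →
      (∀ v ∈ S, ∀ g : Fin n, g ≠ v → w s(v, g) ≠ 0 → ∃ u : Fin n, u ≠ v ∧ u ≠ g ∧ w s(v, u) ≠ 0) →
      (∀ y z : Fin n, ∃ v ∈ S, ∃ u : Fin n, u ∉ S ∧ u ≠ y ∧ u ≠ z ∧ w s(v, u) ≠ 0) →
      (∀ w' : Sym2 (Fin n) → unitInterval,
        (Fintype.card (Sym2 (Fin n)) + 1) * (Finset.univ.filter fun e => w' e ≠ 0).card +
            (Finset.univ.filter fun e => w' e ≠ 0 ∧ w' e ≠ 1).card <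
          (Fintype.card (Sym2 (Fin n)) + 1) * (Finset.univ.filter fun e => w e ≠ 0).card +
            (Finset.univ.filter fun e => w e ≠ 0 ∧ w e ≠ 1).card →
        ∀ (T : Finset (Fin n)) (x : Fin n), Disjoint T A → T.Nonempty → x ∈ A →
        (∀ a ∈ A, (prodBernoulli w').real {ω : BondConfig (Fin n) | (A.filter fun z => ω ∈ openConn a z).card ≤ j} ≤
          (prodBernoulli w').real {ω : BondConfig (Fin n) | (A.filter fun z => ω ∈ openConn x z).card ≤ j}) →
        (prodBernoulli w').real {ω : BondConfig (Fin n) | (∀ y ∈ T, ω ∉ openConn x y) ∧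
            1 ≤ (A.filter fun z => ∃ y ∈ T, ω ∈ openConn y z).card ∧
            (A.filter fun z => ∃ y ∈ T, ω ∈ openConn y z).card ≤ j} ≤
          (prodBernoulli w').real {ω : BondConfig (Fin n) | (∀ y ∈ T, ω ∉ openConn x y) ∧
            (A.filter fun z => ω ∈ openConn x z).card ≤ j}) →
      (prodBernoulli w).real {ω : BondConfig (Fin n) | (∀ y ∈ S, ω ∉ openConn c y) ∧
          1 ≤ (A.filter fun z => ∃ y ∈ S, ω ∈ openConn y z).card ∧
          (A.filter fun z => ∃ y ∈ S, ω ∈ openConn y z).card ≤ j} ≤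
        (prodBernoulli w).real {ω : BondConfig (Fin n) | (∀ y ∈ S, ω ∉ openConn c y) ∧
          (A.filter fun z => ω ∈ openConn c z).card ≤ j}) :
    Summit.CriticalPhenomena.PercolationContinuityZ3.Theses.PercNearOneGluing.NoHeavyLowerTail :=
  noHeavyLowerTail_of_step fun n w A S c j hSA hS2 hcA hchamp hlight hout hna ih =>
    step_dispatch w A S c j hSA hS2 hcA hchamp hout hna ih
      (fun hnp h3 => hcore n w A S c j hSA hS2 hcA hchamp hlight hout hna hnp h3 ih)

end CoreStep

end Summit.CriticalPhenomena.PercolationContinuityZ3.Theorems
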